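import Summits.CriticalPhenomena.PercolationContinuityZ3.Theorems.Transplant.FKConnectivityAllQAntipodalTwoSpineCells
import Summits.CriticalPhenomena.PercolationContinuityZ3.Theorems.Transplant.FKConnectivityAllQAntipodalTwoSpineDiag
import Summits.CriticalPhenomena.PercolationContinuityZ3.Theorems.Transplant.FKConnectivityAllQAntipodalX2SpineRows
import HarnessLib

/-!
# Connectivity correlation inequalities for `φ_{w,q}` — TWO-SPINE word model: the root sum as a sum over CELLS and ATOMS

Helper file (`--supports stmt-CriticalPhenomena-4575`), FK sub-lane `prim-bschramm-fk-2` (gen 16); builds on p205010 (kernel theorem,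
internal audit signed; external expert review pending).  No named facts, no sorries, standard axioms.

Memo `bschramm/FROM-fk-2-g15-TWO-SPINE.md` §10.2/§10.8 and blueprint `prim-bschramm-fk-2-g15/BLUEPRINT-U11-LEAN.md` L2.0/L2.4.  The weighted
sum of the ROOT diagram `⟨[((o,o,o,o),0)],[]⟩` (whose nonnegativity `DStmt` is the two-spine word inequality behind Conjecture U¹¹ at a
series split node) is rewritten as a sum over CELLS `c = ((u, v), j)` (word pair + Janus value) of `(∑_{atoms} ω) · sign · S`, where the
atoms of a cell are the labels `(a, b) ≤ (δ₁, δ₂)` with weights `ω = (1-q)^{a+b} q^{base + 2 - a - b}` (`dsum_root_eq_sum_cells`; the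
atom identity is `pow_two_sub_del` of `…TwoSpineCells`).  Also: membership in `cells` is a condition on the two kind sequences only
(`mem_cells_iff`), so every letter-raising map preserves it (`mem_cells_of_forall₂`).  This is the form in which the summation lemma
`…TwoSpineSumLemma` is applied to gen 15's rule (`…TwoSpineRule`).
[cite: Grimmett2006, §3.9 (p. 63)]
-/

noncomputable section

namespace Summit.CriticalPhenomena.PercolationContinuityZ3.Theorems

namespace FK

namespace TwoSpine

open X2Word

/-! ### Cells and atoms -/

/-- A CELL of the root coefficient: a word pair `(u, v)` together with the Janus value `j` (`y ∈ γ` iff `j`). [folklore] -/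
abbrev Cell := (List SLetter × List SLetter) × Bool

/-- All cells of the shapes `(oA, oB)`. [folklore] -/
def cells (oA oB : List Kind) : Finset Cell := (kindWords oA ×ˢ kindWords oB) ×ˢ (Finset.univ : Finset Bool)

/-- Degree `a + b` of an atom label `(a, b)`. [folklore] -/
def atomDeg (ab : Bool × Bool) : ℕ := (if ab.1 then 1 else 0) + (if ab.2 then 1 else 0)

/-- The ATOMS of a cell: the labels `(a, b)` with `a ≤ δ₁` and `b ≤ δ₂` (as Booleans: `a ⇒ δ₁ = 1`, `b ⇒ δ₂ = 1`). [folklore] -/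
def atoms (c : Cell) : Finset (Bool × Bool) :=
  Finset.univ.filter fun ab => (ab.1 = true → cellDelA c.2 c.1.1 = 1) ∧ (ab.2 = true → cellDelB c.2 c.1.2 = 1)

/-- The WEIGHT of the atom `(a, b)` of a cell: `(1-q)^{a+b} · q^{base + 2 - a - b}`. [folklore] -/
def atomW (q : ℝ) (c : Cell) (ab : Bool × Bool) : ℝ :=
  (1 - q) ^ atomDeg ab * q ^ (baseExp (Mode.o, Mode.o, Mode.o, Mode.o) c.1.1 c.1.2 + (2 - atomDeg ab))

/-- The atom degree is at most `2`. [folklore] -/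
theorem atomDeg_le_two (ab : Bool × Bool) : atomDeg ab ≤ 2 := by
  unfold atomDeg; split <;> split <;> omega

/-- Atom weights are nonnegative for `0 ≤ q ≤ 1`. [folklore] -/
theorem atomW_nonneg {q : ℝ} (hq0 : 0 ≤ q) (hq1 : q ≤ 1) (c : Cell) (ab : Bool × Bool) : 0 ≤ atomW q c ab :=
  mul_nonneg (pow_nonneg (by linarith) _) (pow_nonneg hq0 _)

/-- Membership in `atoms`. [folklore] -/
theorem mem_atoms {c : Cell} {ab : Bool × Bool} :
    ab ∈ atoms c ↔ (ab.1 = true → cellDelA c.2 c.1.1 = 1) ∧ (ab.2 = true → cellDelB c.2 c.1.2 = 1) := by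
  simp [atoms]

/-- The atom identity, summed: `∑_{(a,b) ≤ (δ₁,δ₂)} (1-q)^{a+b} q^{n+2-a-b} = q^n · q^{2-δ₁-δ₂}` for `δ₁, δ₂ ≤ 1`. [folklore] -/
theorem sum_atoms_aux (q : ℝ) (n : ℕ) {d₁ d₂ : ℕ} (h₁ : d₁ ≤ 1) (h₂ : d₂ ≤ 1) :
    ∑ ab ∈ (Finset.univ.filter fun ab : Bool × Bool => (ab.1 = true → d₁ = 1) ∧ (ab.2 = true → d₂ = 1)),
      (1 - q) ^ atomDeg ab * q ^ (n + (2 - atomDeg ab)) = q ^ n * q ^ (2 - d₁ - d₂) := by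
  interval_cases d₁ <;> interval_cases d₂ <;>
    simp [Finset.sum_filter, Fintype.sum_prod_type, atomDeg, pow_add] <;> ring

/-- **The atoms of a cell carry its weight**: `∑_{atoms} ω = q^{base} · q^{2 - δ₁ - δ₂}`. [folklore] -/
theorem sum_atoms_atomW (q : ℝ) (c : Cell) :
    ∑ ab ∈ atoms c, atomW q c ab =
      q ^ baseExp (Mode.o, Mode.o, Mode.o, Mode.o) c.1.1 c.1.2 * q ^ (2 - cellDelA c.2 c.1.1 - cellDelB c.2 c.1.2) :=
  sum_atoms_aux q _ (cellDelA_le_one _ _) (cellDelB_le_one _ _)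

/-! ### The root sum as a sum over cells -/

/-- The weighted sum of the ROOT diagram is the plain double sum of `Θ · S₀`. [folklore] -/
theorem dsum_root (q : ℝ) (top : Top) (m : Modes) (oA oB : List Kind) (S : ℕ → List SLetter → List SLetter → ℝ) :
    dsum q top ⟨[(m, 0)], []⟩ oA oB S = ∑ u ∈ kindWords oA, ∑ v ∈ kindWords oB, theta q top m u v * S 0 u v := by
  simp [dsum]

/-- **The root sum over cells and atoms** (series top): `dsum(root) = ∑_{cells c} (∑_{atoms} ω) · sign(c) · S₀(c)`. [folklore] -/
theorem dsum_root_eq_sum_cells (q : ℝ) (oA oB : List Kind) (S : ℕ → List SLetter → List SLetter → ℝ) :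
    dsum q .W ⟨[((Mode.o, Mode.o, Mode.o, Mode.o), 0)], []⟩ oA oB S =
      ∑ c ∈ cells oA oB, (∑ ab ∈ atoms c, atomW q c ab) * cellSign c.2 c.1.1 c.1.2 * S 0 c.1.1 c.1.2 := by
  rw [dsum_root]
  unfold cells
  rw [Finset.sum_product, Finset.sum_product]
  refine Finset.sum_congr rfl fun u _ => Finset.sum_congr rfl fun v _ => ?_
  rw [Fintype.sum_bool, sum_atoms_atomW, sum_atoms_atomW, theta_W_root]
  simp only
  ring

/-! ### Membership in `cells` depends on the kind sequences only -/

/-- Membership in `cells`: the two kind sequences are the two shapes. [folklore] -/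
theorem mem_cells_iff {oA oB : List Kind} {c : Cell} :
    c ∈ cells oA oB ↔ c.1.1.map (·.1) = oA ∧ c.1.2.map (·.1) = oB := by
  simp [cells, mem_kindWords]

/-- Letter-raising maps on both words (and any Janus value) preserve membership in `cells`. [folklore] -/
theorem mem_cells_of_forall₂ {oA oB : List Kind} {c : Cell} (hc : c ∈ cells oA oB) {u' v' : List SLetter} (j' : Bool)
    (hu : List.Forall₂ (fun a b : SLetter => b = a ∨ (a.2 = (false, true) ∧ b = (a.1, true, false))) c.1.1 u')
    (hv : List.Forall₂ (fun a b : SLetter => b = a ∨ (a.2 = (false, true) ∧ b = (a.1, true, false))) c.1.2 v') :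
    ((u', v'), j') ∈ cells oA oB := by
  rw [mem_cells_iff] at hc ⊢
  exact ⟨(map_fst_eq_of_forall₂_flip hu).trans hc.1, (map_fst_eq_of_forall₂_flip hv).trans hc.2⟩

/-- The row exchange preserves the kind sequence. [folklore] -/
theorem map_fst_map_swapLetter (w : List SLetter) : (w.map swapLetter).map (·.1) = w.map (·.1) := by
  rw [List.map_map]; rfl

end TwoSpine

end FK

end Summit.CriticalPhenomena.PercolationContinuityZ3.Theorems

end
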